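/-
Copyright: the b2b-balaban cell (near-miss cell 7), T⁴-continuum fan-out; row NE7b ROUND-2 swarm, seat
t4-ne7b-formalise-leaf-05 gen 4 (row S6g′ INSTANCE of `t4/b2b-balaban-t4-ne7b-p1/LEAVES-NE7b.md`, owner's rulings
R-OWNER-23-3…-7: T3b, file 5 «MULT» — the image count).  Released under the licence of the surrounding project.
-/
import Summits.QuantumFields.BalabanUV.T4Continuum.Support.HistoryJoinsPlacedMember
import Summits.QuantumFields.BalabanUV.T4Continuum.Support.HistoryJoinsPlacedTwin
import Summits.QuantumFields.BalabanUV.T4Continuum.Support.HistoryAssemblyMultKey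
import Summits.QuantumFields.BalabanUV.T4Continuum.Support.HistoryRealiseCellsRun

/-!
# T3b, file 5 «MULT»: the slot multiplicity of the ORDER-FREE occupant key is an image count into the counted set
# (row S6g′ INSTANCE — `#koccOf ≤ A(tcap (fat root)) · #S`)

Summits-side support leaf of the T⁴-continuum cell (rung (B)+1 on a FINITE torus only; NOT infinite volume, NOT the
mass gap, NOT the Clay statement; NOT a proof of the spine estimate NE7b).  Row NE7b, route «COUNT», row S6g′ INSTANCE,
piece T3b (R-OWNER-23-3 (2)(ii), -23-5 (1)(2), -23-6).  [folklore] finite combinatorics over the lineage's own carriers: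
leaf-03 gen 2's key∕slot∕occupants (`HistoryAssemblyMultKey.keyOf`∕`kslot`∕`koccOf`), leaf-08 gen 2's root cell
`cellOfR` (= `cornerCell`), file 4's `exists_mem_S_sortR`, file 1's `valP`, leaf-10 gen 3∕5's `sortR_gen_eq_iff` ∕
`rootStep_toPGen_sortR` ∕ `toGen_toPGen_sortR`, leaf-09's `root_kind_step`; nothing is quoted from print, nothing
printed is asserted, no `[cite:]` tag, no `Prop` fact minted; two plain functions (`untypeV`, `physV`).

WHAT.
* **`physV`** — THE PHYSICAL DATUM OF RECORD (R-OWNER-23-5 (2), option 1): the multiset of (label, VALUE) over the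
  physical births of the live component's realised member, the value `valP` (corner cell at the level of the birth step
  in the run, template) read into a cutoff-free carrier (`untypeV`: coordinates of the cell, cubes of the template) so
  that `phys : ℕ → ι → α → δ` has ONE type for all cutoffs `K`.
* **`card_koccOf_le`** — for a term `τ ∈ T K` and a live component `c`: the number of DISTINCT keys (root cell, flat
  genealogy, physical datum) of bad terms' live components in the tree slot of `c` is at most
  `A d (M K) (tcap d (fat (root Ĝ))) · B`, `Ĝ := (ped K τ).sortR.gen c` the counted sorted twin, for every bound `B` of the
  counted sets `#S (zoneP n L K (levelOf (s K) K) 32 c₀) ρ c₀ PEv.step Ĝ z` uniform in the root datum `z` (file B2 ∕ the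
  twin END supply `B`): every occupant key `w` is realised by some `(τ′, c′)`; file 4 gives a counted placement `P′_w`
  of `(ped K τ′).sortR.gen c′ = Ĝ` (`sortR_gen_eq_iff`: same flat tree ⇒ same sorted twin) whose births' reading is
  `w`'s datum — so `w ↦ P′_w` is INJECTIVE on the slot — with root datum `(y, T)`, `y` THE cell of the slot's root cell
  `x` (`inBox`: `cellV` = `cornerCell` without wrap) and `T` a template of `≤ tcap d (fat root)` cubes.
  DISPLAYED (hypotheses, H3-side): `HeadOldest`∕`RenewDated` of the terms' pedigrees, `Realises` + `lastStep ≤ K` of the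
  live members (`real`), `inBox` of their root anchors, `step ≤ K`, the type bound `tcap d fat ≤ M K`, the duplicate-free
  clause `hdis : (physV … K τ′ c′).Nodup` (R-OWNER-23-6), the depth of the space, the run's letters.

HONEST SCOPE.  Counting over OUR carriers; every H3-side item above is a HYPOTHESIS, not discharged; `hmult` of leaf-03
gen 2's END v2 follows from this × the twin END × `bsum ≤ birthLinT` (the LAST JUNCTION, next); `resum`∕`BirthShapeNodup`
NOT retired; NE7b NOT proved.  HONEST DEPENDENCY (cell): continuum YM on T⁴ ⇐ BetaPertH ∧ nine spine estimates (0/9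
proved); BetaPertH ⇐ (D1) ∧ (D4) ∧ CAP+tail; G-an2-4 gates asym, D1 and NE2/3/4.  This file changes none of it.
-/

open Finset
open Literature.MathematicalPhysics.QuantumFieldTheory.Balaban1983to89
open Literature.MathematicalPhysics.QuantumFieldTheory.Balaban1983to89.B13ScaleTransfer (Pt FaceConnected)
open Literature.MathematicalPhysics.QuantumFieldTheory.Balaban1983to89.B16SProfile (DropCtl)
open T4PersistenceDictionary T4PartnerMultiplicity T4BranchingRecordsGas
open Summit.QuantumFields.BalabanUV.T4Continuum.ZoneTorus
open Summit.QuantumFields.BalabanUV.T4Continuum.HistoryZones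
open Summit.QuantumFields.BalabanUV.T4Continuum.HistoryAdmissible
open Summit.QuantumFields.BalabanUV.T4Continuum.HistoryRealise
open Summit.QuantumFields.BalabanUV.T4Continuum.HistoryRealiseCells
open Summit.QuantumFields.BalabanUV.T4Continuum.HistoryRealiseCellsRun
open Summit.QuantumFields.BalabanUV.T4Continuum.HistoryGen
open Summit.QuantumFields.BalabanUV.T4Continuum.HistoryJoins
open Summit.QuantumFields.BalabanUV.T4Continuum.HistoryJoinsAdm
open Summit.QuantumFields.BalabanUV.T4Continuum.HistoryJoinsRearrange
open Summit.QuantumFields.BalabanUV.T4Continuum.HistoryAssemblyTerms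
open Summit.QuantumFields.BalabanUV.T4Continuum.HistoryAssemblyPedigree
open Summit.QuantumFields.BalabanUV.T4Continuum.HistoryAssemblyMultKey
open Summit.QuantumFields.BalabanUV.T4Continuum.HistoryRegionTemplates
open Summit.QuantumFields.BalabanUV.T4Continuum.HistoryJoinsTemplates
open Summit.QuantumFields.BalabanUV.T4Continuum.HistoryJoinsPlacedZone
open Summit.QuantumFields.BalabanUV.T4Continuum.HistoryJoinsPlacedValue
open Summit.QuantumFields.BalabanUV.T4Continuum.HistoryJoinsPlacedTagged
open Summit.QuantumFields.BalabanUV.T4Continuum.HistoryJoinsPlacedMember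
open Summit.QuantumFields.BalabanUV.T4Continuum.HistorySiblingEntropyBridge
open Summit.QuantumFields.BalabanUV.T4Continuum.HistorySlots

namespace Summit.QuantumFields.BalabanUV.T4Continuum.HistoryJoinsPlacedMult

noncomputable section

open scoped Classical

/-! ## §1 The physical datum of record -/

section Datum

variable {d : ℕ}

/-- the cutoff-free reading of a placement value: the cell's coordinates and the template's cubes [folklore] -/
def untypeV {N M : ℕ} (v : TCell d N × Template d M) : (Fin d → ℕ) × Finset (Pt d) := (fun i => (v.1 i).val, v.2.1)

/-- the cutoff-free reading is injective [folklore] -/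
theorem untypeV_injective (N M : ℕ) : Function.Injective (untypeV (d := d) (N := N) (M := M)) := by
  intro v w h
  simp only [untypeV, Prod.mk.injEq] at h
  refine Prod.ext (funext fun i => Fin.ext (congrFun h.1 i)) (Template.ext h.2)

/-- positivity of the torus side [folklore] -/
theorem side_pos {n L : ℕ} (hn : 0 < n) (hL : 0 < L) (K : ℕ) : 0 < n * L ^ K := Nat.mul_pos hn (pow_pos hL K)

/-- **THE PHYSICAL DATUM OF RECORD** (R-OWNER-23-5 (2), option 1): the multiset of (label, value) over the physical
births of the live component's realised member, values by file 1's `valP` at the run's levels `levelOf (s K) K`, read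
cutoff-free. [folklore] -/
def physV {ι α π : Type*} (n L : ℕ) (hn : 0 < n) (hL : 0 < L) (M : ℕ → ℕ) (hM : ∀ K, 1 ≤ M K) (s : ℕ → ℕ → ℕ)
    (ped : ℕ → ι → Pedigree α π) (cellP : ℕ → ι → π → Pt d × Finset (Pt d)) (K : ℕ) (τ : ι) (c : α) :
    Multiset (PEv × ((Fin d → ℕ) × Finset (Pt d))) :=
  (PGen.pbirths ((ped K τ).toPGen (cellP K τ) c)).map fun bz =>
    (bz.1, untypeV (valP n L K (side_pos hn hL K) (levelOf (s K) K) (M K) (hM K) bz.1 bz.2))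

variable {ι α π : Type*} {n L : ℕ} {hn : 0 < n} {hL : 0 < L} {M : ℕ → ℕ} {hM : ∀ K, 1 ≤ M K} {s : ℕ → ℕ → ℕ}
  {ped : ℕ → ι → Pedigree α π} {cellP : ℕ → ι → π → Pt d × Finset (Pt d)}

/-- the datum of record is the typed value multiset read cutoff-free [folklore] -/
theorem physV_eq_map (K : ℕ) (τ : ι) (c : α) :
    physV n L hn hL M hM s ped cellP K τ c =
      ((PGen.pbirths ((ped K τ).toPGen (cellP K τ) c)).map fun bz =>
        (bz.1, valP n L K (side_pos hn hL K) (levelOf (s K) K) (M K) (hM K) bz.1 bz.2)).map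
        (fun bv => (bv.1, untypeV bv.2)) := by
  rw [physV, Multiset.map_map]; rfl

/-- the duplicate-free clause in the letters of record gives the typed one [folklore] -/
theorem nodup_typed_of_nodup_physV {K : ℕ} {τ : ι} {c : α} (h : (physV n L hn hL M hM s ped cellP K τ c).Nodup) :
    ((PGen.pbirths ((ped K τ).toPGen (cellP K τ) c)).map fun bz =>
        (bz.1, valP n L K (side_pos hn hL K) (levelOf (s K) K) (M K) (hM K) bz.1 bz.2)).Nodup := by
  rw [physV_eq_map] at h
  exact Multiset.Nodup.of_map _ h

end Datum

/-! ## §2 The image count -/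

section Count

variable {ι α π : Type*} [DecidableEq α] [DecidableEq π] {d n L D : ℕ} (hn : 0 < n) (hL3 : 3 ≤ L)
  (M : ℕ → ℕ) (hM : ∀ K, 1 ≤ M K) (s : ℕ → ℕ → ℕ) (ped : ℕ → ι → Pedigree α π)
  (cellP : ℕ → ι → π → Pt d × Finset (Pt d)) (liveC : ℕ → ι → Finset α) (jstar : ℕ → ℕ) (T : ℕ → Finset ι)
  (R : ℕ → ℕ → ℕ) {K : ℕ} (c₀ : TCell d (n * L ^ K) × Template d (M K))
  {R' : Type*} [LinearOrder R'] (ρ : (Addr D → TCell d (n * L ^ K) × Template d (M K)) → R')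

/-- the slot of a key fixes its root cell and its flat genealogy [folklore] -/
theorem fst_eq_of_kslot_eq {γ δ : Type*} {w w' : γ × Gen PEv × δ} (h : kslot w = kslot w') :
    w.1 = w'.1 ∧ w.2.1 = w'.2.1 :=
  ⟨congrArg (fun sl : BSlot γ PEv => sl.2.1) h, congrArg (fun sl : BSlot γ PEv => sl.2.2) h⟩

include hL3 in
/-- **THE IMAGE COUNT — ROW S6g′ INSTANCE, T3b (ii).**  For `τ ∈ T K` and a live `c`, with `Ĝ := (ped K τ).sortR.gen c`:
`#koccOf … K (kslot (keyOf … K τ c)) ≤ A d (M K) (tcap d (fat (root Ĝ))) · B` for every uniform bound `B` of the counted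
sets `#S (zoneP n L K (levelOf (s K) K) 32 c₀) ρ c₀ PEv.step Ĝ z`. [folklore] -/
theorem card_koccOf_le (hL : 0 < L) (hρ : Function.Injective ρ) (hs : ∀ t, s K (t + 1) ≤ s K t)
    (hdrop : ∀ m, DropCtl (s K) m)
    (hH : ∀ τ ∈ T K, ∀ c, (ped K τ).HeadOldest c) (hS : ∀ τ ∈ T K, (ped K τ).RenewDated)
    (hreal : ∀ τ ∈ T K, ∀ c ∈ liveC K τ, ∃ Z, Realises L (s K) (R K) ((ped K τ).toPGen (cellP K τ) c) Z ∧
      ((ped K τ).toPGen (cellP K τ) c).lastStep ≤ K)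
    (hinBox : ∀ τ ∈ T K, ∀ c ∈ liveC K τ, ∀ i, 0 ≤ rootAnchor ((ped K τ).toPGen (cellP K τ) c) i ∧
      L ^ levelOf (s K) K ((ped K τ).toPGen (cellP K τ) c).rootStep *
        (rootAnchor ((ped K τ).toPGen (cellP K τ) c) i).toNat < n * L ^ K)
    (hstep : ∀ τ ∈ T K, ∀ c ∈ liveC K τ, (ped K τ).step c ≤ K)
    (hMf : ∀ τ ∈ T K, ∀ c ∈ liveC K τ, ∀ bz ∈ PGen.pbirths ((ped K τ).toPGen (cellP K τ) c), tcap d bz.1.fat ≤ M K)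
    (hdis : ∀ τ ∈ badTerms (memOf ped liveC (cellOfR n L s ped cellP)) jstar T K, ∀ c ∈ liveC K τ,
      (physV n L hn hL M hM s ped cellP K τ c).Nodup)
    {τ : ι} (hτ : τ ∈ T K) (c : α)
    (hD : ∀ a ∈ baddr ((ped K τ).sortR.gen c), a.length ≤ D)
    {B : ℕ} (hB : ∀ z, (S (zoneP n L K (levelOf (s K) K) 32 c₀) ρ c₀ PEv.step ((ped K τ).sortR.gen c) z).card ≤ B) :
    (koccOf ped liveC (cellOfR n L s ped cellP) (physV n L hn hL M hM s ped cellP) jstar T K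
        (kslot (keyOf ped (cellOfR n L s ped cellP) (physV n L hn hL M hM s ped cellP) K τ c))).card ≤
      A d (M K) (tcap d ((ped K τ).sortR.gen c).root.fat) * B := by
  -- letters
  have hN : 0 < n * L ^ K := side_pos hn hL K
  set lv := levelOf (s K) K with hlv_def
  have hlvF : LevelFn K lv := levelFn_levelOf (fun t _ => hs t) (hdrop K)
  set cellOf := cellOfR n L s ped cellP with hcellOf
  set phys := physV n L hn hL M hM s ped cellP with hphys
  set x := cellOf K τ c with hx
  set G := (ped K τ).gen c with hG
  set Ghat := (ped K τ).sortR.gen c with hGhat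
  set sl := kslot (keyOf ped cellOf phys K τ c) with hsl
  set W := koccOf ped liveC cellOf phys jstar T K sl with hW
  set V : PEv → Pt d × Finset (Pt d) → TCell d (n * L ^ K) × Template d (M K) :=
    valP n L K hN lv (M K) (hM K) with hV
  set y : TCell d (n * L ^ K) := fun i => ⟨x i % (n * L ^ K), Nat.mod_lt _ hN⟩ with hy
  set TT : Finset (Template d (M K)) := univ.filter fun T => T.1.card ≤ tcap d Ghat.root.fat with hTT
  have hslx : sl.2.1 = x := rfl
  have hslG : sl.2.2 = G := rfl
  -- every occupant key: a counted placement of `Ghat` with root datum `(y, T)`, `T ∈ TT`, reading the key's datum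
  have key : ∀ w ∈ W, ∃ P' : Addr D → TCell d (n * L ^ K) × Template d (M K),
      (bread c₀ Ghat P').map (fun bv => (bv.1, untypeV bv.2)) = w.2.2 ∧
        ∃ T ∈ TT, P' ∈ S (zoneP n L K lv 32 c₀) ρ c₀ PEv.step Ghat (y, T) := by
    intro w hw
    obtain ⟨τ', hτ', c', hc', hkey, hslot⟩ := mem_koccOf.1 hw
    have hT' : τ' ∈ T K := (mem_badTerms.1 hτ').1
    set P' := ped K τ' with hP'
    set g' := P'.toPGen (cellP K τ') c' with hg'
    obtain ⟨Z', hR', hK'⟩ := hreal τ' hT' c' hc'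
    -- the key's components
    have hks := fst_eq_of_kslot_eq (hslot.trans hsl)
    have hw1 : w.1 = x := hks.1
    have hw21 : w.2.1 = G := hks.2
    have hkw : w = (cellOf K τ' c', P'.gen c', phys K τ' c') := hkey.symm
    have hw22 : w.2.2 = phys K τ' c' := by rw [hkw]
    have hgen : P'.gen c' = G := by rw [← hw21, hkw]
    have hxw : x = cellOf K τ' c' := by rw [← hw1, hkw]
    -- the same sorted twin
    have htwin : P'.sortR.gen c' = Ghat :=
      (sortR_gen_eq_iff P' (ped K τ) (hH τ' hT') (hS τ' hT') (hH τ hτ) (hS τ hτ) c' c).2 (by rw [hgen])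
    have hD' : ∀ a ∈ baddr (P'.sortR.gen c'), a.length ≤ D := by rw [htwin]; exact hD
    -- file 4
    obtain ⟨Q, hbQ, hmQ⟩ := exists_mem_S_sortR P' (cellP K τ') hN (hM K) c₀ ρ hL3 hn hs hdrop hρ (hH τ' hT')
      (hS τ' hT') c' hR' hK' (hstep τ' hT' c' hc') hD' (hMf τ' hT' c' hc')
      (nodup_typed_of_nodup_physV (hdis τ' hτ' c' hc'))
    rw [htwin] at hbQ hmQ
    refine ⟨Q, ?_, ?_⟩
    · rw [hbQ, hw22, hphys, physV_eq_map]
    · -- the root datum: the cell of the slot's root cell, and a small template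
      have hroot : (Gen.root Ghat).step = g'.rootStep := by
        rw [← htwin, ← P'.toGen_toPGen_sortR (cellP K τ') (hS τ' hT') c', (root_kind_step _).2,
          P'.rootStep_toPGen_sortR (cellP K τ') (hH τ' hT') (hS τ' hT') c']
      have hjK : g'.rootStep ≤ K := (lastStep_realises_le g' Z' hR').trans hK'
      have hlvK : lv g'.rootStep ≤ K := hlvF.le_K _ hjK
      -- no wrap for the root anchor
      have hanc : ∀ i, res (n * L ^ (K - lv g'.rootStep)) (rootAnchor g' i) = (rootAnchor g' i).toNat ∧
          (L ^ lv g'.rootStep * (rootAnchor g' i).toNat) % (n * L ^ K) = x i := by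
        intro i
        obtain ⟨h0, hlt⟩ := hinBox τ' hT' c' hc' i
        have hx' : x i = cellOfR n L s ped cellP K τ' c' i := by rw [hxw]
        refine ⟨?_, ?_⟩
        · have hlt' : (rootAnchor g' i).toNat < n * L ^ (K - lv g'.rootStep) := by
            have : n * L ^ K = L ^ lv g'.rootStep * (n * L ^ (K - lv g'.rootStep)) := by
              rw [mul_left_comm, ← pow_add, Nat.add_sub_cancel' hlvK]
            rw [this] at hlt
            exact Nat.lt_of_mul_lt_mul_left hlt
          conv_lhs => rw [← Int.toNat_of_nonneg h0]
          exact res_natCast_of_lt hlt'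
        · rw [hx']; rfl
      have hcell : (V (Gen.root Ghat) g'.rootCell).1 = y := by
        funext i
        apply Fin.ext
        show (L ^ lv (Gen.root Ghat).step * res (n * L ^ (K - lv (Gen.root Ghat).step)) (rootAnchor g' i)) %
            (n * L ^ K) = x i % (n * L ^ K)
        rw [hroot, (hanc i).1, ← (hanc i).2, Nat.mod_mod]
      refine ⟨(V (Gen.root Ghat) g'.rootCell).2, ?_, ?_⟩
      · rw [hTT, mem_filter]
        exact ⟨mem_univ _, card_tmplV_le (hM K) _ _⟩
      · have hval : V (Gen.root Ghat) g'.rootCell = (y, (V (Gen.root Ghat) g'.rootCell).2) :=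
          Prod.ext hcell rfl
        rw [← hval]
        exact hmQ
  -- the injection
  haveI : Nonempty (Addr D → TCell d (n * L ^ K) × Template d (M K)) := ⟨fun _ => c₀⟩
  choose! F hFb hFm using key
  have step1 : W.card ≤ (TT.biUnion fun T => S (zoneP n L K lv 32 c₀) ρ c₀ PEv.step Ghat (y, T)).card := by
    refine card_le_card_of_injOn F (fun w hw => ?_) (fun w₁ hw₁ w₂ hw₂ hF => ?_)
    · obtain ⟨T, hT, hm⟩ := hFm w (mem_coe.1 hw)
      exact mem_coe.2 (mem_biUnion.2 ⟨T, hT, hm⟩)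
    · rw [mem_coe] at hw₁ hw₂
      have e1 := hFb w₁ hw₁
      have e2 := hFb w₂ hw₂
      rw [hF] at e1
      obtain ⟨-, -, -, -, -, hs₁⟩ := mem_koccOf.1 hw₁
      obtain ⟨-, -, -, -, -, hs₂⟩ := mem_koccOf.1 hw₂
      have h12 := fst_eq_of_kslot_eq (hs₁.trans hs₂.symm)
      exact Prod.ext h12.1 (Prod.ext h12.2 (e1.symm.trans e2))
  calc W.card ≤ (TT.biUnion fun T => S (zoneP n L K lv 32 c₀) ρ c₀ PEv.step Ghat (y, T)).card := step1
    _ ≤ ∑ T ∈ TT, (S (zoneP n L K lv 32 c₀) ρ c₀ PEv.step Ghat (y, T)).card := card_biUnion_le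
    _ ≤ ∑ _T ∈ TT, B := sum_le_sum fun T _ => hB _
    _ = TT.card * B := by rw [sum_const, smul_eq_mul]
    _ = A d (M K) (tcap d Ghat.root.fat) * B := rfl

end Count

/-! ## §3 (v1.1) Glue handed to the LAST JUNCTION (leaf-03 gen 3): `hdis` converse, `z`-free real form, twin END plugged in

`nodup_physV_of_nodup_typed`∕`nodup_physV_iff` — the TYPED duplicate-free clause (conclusion of leaf-08 gen 4's
`HistoryRealiseDistinctValue.hdis_of_realisesD`) ⇔ the clause of record (leaf-01 gen 5's XREAD P1); `card_koccOf_le_real` —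
a uniform REAL bound `X` of the counted sets (`B := ⌊X⌋₊`, P3); **`card_koccOf_le_exp_pow`** — file 3's twin END
`card_S_sortR_le_exp_pow` plugged in at `levelOf (s K) K`, thickening `32`, the counting devices `D`, `c₀`, `ρ` CHOSEN:
`#koccOf ≤ A·(exp(Θ·bsum (fat+1) (gen c) + (8/φ)·totalCostT Prod.fst C K Rt (genT c))·(L^d·e^4)^(partnerAges PEv.step (gen c)))`
= the input shape `N ≤ A·(exp(Θ·B + E)·(Λ·e^4)^p)` of `HistoryAssemblyMultLetters.le_exp_mul_pow_of_twin` (`B ≤ birthLinT`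
by `bsum_gen_le_birthLinT_genT`, `p` by `partnerAges_gen`); the twin END's H1b∕run-side letters are displayed. -/

section DatumConverse

variable {ι α π : Type*} {d n L : ℕ} {hn : 0 < n} {hL : 0 < L} {M : ℕ → ℕ} {hM : ∀ K, 1 ≤ M K} {s : ℕ → ℕ → ℕ}
  {ped : ℕ → ι → Pedigree α π} {cellP : ℕ → ι → π → Pt d × Finset (Pt d)}

/-- the converse of `nodup_typed_of_nodup_physV` (`untypeV` is injective): the TYPED duplicate-free clause — the
conclusion of leaf-08 gen 4's `HistoryRealiseDistinctValue.hdis_of_realisesD` — gives the clause of record. [folklore] -/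
theorem nodup_physV_of_nodup_typed {K : ℕ} {τ : ι} {c : α}
    (h : ((PGen.pbirths ((ped K τ).toPGen (cellP K τ) c)).map fun bz =>
        (bz.1, valP n L K (side_pos hn hL K) (levelOf (s K) K) (M K) (hM K) bz.1 bz.2)).Nodup) :
    (physV n L hn hL M hM s ped cellP K τ c).Nodup := by
  rw [physV_eq_map]
  exact Multiset.Nodup.map
    (fun bv bv' hvv => Prod.ext (Prod.mk.inj hvv).1 (untypeV_injective _ _ (Prod.mk.inj hvv).2)) h

/-- the duplicate-free clause of record and the typed one are EQUIVALENT. [folklore] -/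
theorem nodup_physV_iff {K : ℕ} {τ : ι} {c : α} :
    (physV n L hn hL M hM s ped cellP K τ c).Nodup ↔
      ((PGen.pbirths ((ped K τ).toPGen (cellP K τ) c)).map fun bz =>
        (bz.1, valP n L K (side_pos hn hL K) (levelOf (s K) K) (M K) (hM K) bz.1 bz.2)).Nodup :=
  ⟨nodup_typed_of_nodup_physV, nodup_physV_of_nodup_typed⟩

end DatumConverse

section CountReal

open Summit.QuantumFields.BalabanUV.T4Continuum.HistoryZoneEvolve (cth)
open Summit.QuantumFields.BalabanUV.T4Continuum.HistoryBankingLE (ConsistentTLE totalCostT)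
open Summit.QuantumFields.BalabanUV.T4Continuum.HistoryJoinsPlacedTwin (card_S_sortR_le_exp_pow)

variable {ι α π : Type*} [DecidableEq α] [DecidableEq π] {d n L D : ℕ} (hn : 0 < n) (hL3 : 3 ≤ L)
  (M : ℕ → ℕ) (hM : ∀ K, 1 ≤ M K) (s : ℕ → ℕ → ℕ) (ped : ℕ → ι → Pedigree α π)
  (cellP : ℕ → ι → π → Pt d × Finset (Pt d)) (liveC : ℕ → ι → Finset α) (jstar : ℕ → ℕ) (T : ℕ → Finset ι)
  (R : ℕ → ℕ → ℕ) {K : ℕ} (c₀ : TCell d (n * L ^ K) × Template d (M K))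
  {R' : Type*} [LinearOrder R'] (ρ : (Addr D → TCell d (n * L ^ K) × Template d (M K)) → R')

include hL3 in
/-- `card_koccOf_le` with a uniform REAL bound `X` of the counted sets: `#koccOf … ≤ A · X` (`B := ⌊X⌋₊`). [folklore] -/
theorem card_koccOf_le_real (hL : 0 < L) (hρ : Function.Injective ρ) (hs : ∀ t, s K (t + 1) ≤ s K t)
    (hdrop : ∀ m, DropCtl (s K) m)
    (hH : ∀ τ ∈ T K, ∀ c, (ped K τ).HeadOldest c) (hS : ∀ τ ∈ T K, (ped K τ).RenewDated)
    (hreal : ∀ τ ∈ T K, ∀ c ∈ liveC K τ, ∃ Z, Realises L (s K) (R K) ((ped K τ).toPGen (cellP K τ) c) Z ∧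
      ((ped K τ).toPGen (cellP K τ) c).lastStep ≤ K)
    (hinBox : ∀ τ ∈ T K, ∀ c ∈ liveC K τ, ∀ i, 0 ≤ rootAnchor ((ped K τ).toPGen (cellP K τ) c) i ∧
      L ^ levelOf (s K) K ((ped K τ).toPGen (cellP K τ) c).rootStep *
        (rootAnchor ((ped K τ).toPGen (cellP K τ) c) i).toNat < n * L ^ K)
    (hstep : ∀ τ ∈ T K, ∀ c ∈ liveC K τ, (ped K τ).step c ≤ K)
    (hMf : ∀ τ ∈ T K, ∀ c ∈ liveC K τ, ∀ bz ∈ PGen.pbirths ((ped K τ).toPGen (cellP K τ) c), tcap d bz.1.fat ≤ M K)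
    (hdis : ∀ τ ∈ badTerms (memOf ped liveC (cellOfR n L s ped cellP)) jstar T K, ∀ c ∈ liveC K τ,
      (physV n L hn hL M hM s ped cellP K τ c).Nodup)
    {τ : ι} (hτ : τ ∈ T K) (c : α)
    (hD : ∀ a ∈ baddr ((ped K τ).sortR.gen c), a.length ≤ D)
    {X : ℝ} (hX : ∀ z, ((S (zoneP n L K (levelOf (s K) K) 32 c₀) ρ c₀ PEv.step ((ped K τ).sortR.gen c) z).card : ℝ) ≤ X) :
    ((koccOf ped liveC (cellOfR n L s ped cellP) (physV n L hn hL M hM s ped cellP) jstar T K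
        (kslot (keyOf ped (cellOfR n L s ped cellP) (physV n L hn hL M hM s ped cellP) K τ c))).card : ℝ) ≤
      (A d (M K) (tcap d ((ped K τ).sortR.gen c).root.fat) : ℝ) * X := by
  have hX0 : 0 ≤ X := (Nat.cast_nonneg _).trans (hX c₀)
  have hB : ∀ z, (S (zoneP n L K (levelOf (s K) K) 32 c₀) ρ c₀ PEv.step ((ped K τ).sortR.gen c) z).card ≤ ⌊X⌋₊ :=
    fun z => Nat.le_floor (hX z)
  have h := card_koccOf_le hn hL3 M hM s ped cellP liveC jstar T R c₀ ρ hL hρ hs hdrop hH hS hreal hinBox hstep hMf hdis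
    hτ c hD hB
  calc ((koccOf ped liveC (cellOfR n L s ped cellP) (physV n L hn hL M hM s ped cellP) jstar T K
          (kslot (keyOf ped (cellOfR n L s ped cellP) (physV n L hn hL M hM s ped cellP) K τ c))).card : ℝ)
        ≤ ((A d (M K) (tcap d ((ped K τ).sortR.gen c).root.fat) * ⌊X⌋₊ : ℕ) : ℝ) := by exact_mod_cast h
    _ = (A d (M K) (tcap d ((ped K τ).sortR.gen c).root.fat) : ℝ) * (⌊X⌋₊ : ℝ) := Nat.cast_mul _ _
    _ ≤ (A d (M K) (tcap d ((ped K τ).sortR.gen c).root.fat) : ℝ) * X :=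
        mul_le_mul_of_nonneg_left (Nat.floor_le hX0) (Nat.cast_nonneg _)

include hL3 in
omit [LinearOrder R'] in
/-- **THE IMAGE COUNT × THE TWIN END — ROW S6g′ INSTANCE, T3b (ii) × T3a, the `z`-free form handed to the LAST JUNCTION.**
For `τ ∈ T K` and a component `c` of step `≤ K` (forest ancestries, `ConsistentTLE` tagged member, floors `≥ φ > 0`):
`#koccOf … ≤ A d (M K) (tcap d (fat (root Ĝ))) · (exp(Θ · bsum (fat + 1) (gen c) + (8/φ) · totalCostT Prod.fst C K Rt (genT c))
· (L^d · e^4)^(partnerAges PEv.step (gen c)))`, `Θ` B2's closed constant at thickening `32`.  The counting devices — depth `D`,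
junk datum `c₀`, tie-break order `ρ` (the instance seat's choices) — are CHOSEN here: `D :=` the depth of `Ĝ`, `c₀ :=` (cell
`0`, one-cube template), `ρ := Fintype.equivFin`; DISPLAYED: the letters of `card_koccOf_le` and of the twin END. [folklore] -/
theorem card_koccOf_le_exp_pow (hL : 0 < L) (hs : ∀ t, s K (t + 1) ≤ s K t)
    (hdrop : ∀ m, DropCtl (s K) m)
    (hH : ∀ τ ∈ T K, ∀ c, (ped K τ).HeadOldest c) (hS : ∀ τ ∈ T K, (ped K τ).RenewDated)
    (hreal : ∀ τ ∈ T K, ∀ c ∈ liveC K τ, ∃ Z, Realises L (s K) (R K) ((ped K τ).toPGen (cellP K τ) c) Z ∧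
      ((ped K τ).toPGen (cellP K τ) c).lastStep ≤ K)
    (hinBox : ∀ τ ∈ T K, ∀ c ∈ liveC K τ, ∀ i, 0 ≤ rootAnchor ((ped K τ).toPGen (cellP K τ) c) i ∧
      L ^ levelOf (s K) K ((ped K τ).toPGen (cellP K τ) c).rootStep *
        (rootAnchor ((ped K τ).toPGen (cellP K τ) c) i).toNat < n * L ^ K)
    (hstep : ∀ τ ∈ T K, ∀ c ∈ liveC K τ, (ped K τ).step c ≤ K)
    (hMf : ∀ τ ∈ T K, ∀ c ∈ liveC K τ, ∀ bz ∈ PGen.pbirths ((ped K τ).toPGen (cellP K τ) c), tcap d bz.1.fat ≤ M K)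
    (hdis : ∀ τ ∈ badTerms (memOf ped liveC (cellOfR n L s ped cellP)) jstar T K, ∀ c ∈ liveC K τ,
      (physV n L hn hL M hM s ped cellP K τ c).Nodup)
    {τ : ι} (hτ : τ ∈ T K) (hF : ∀ c, (ped K τ).Forest c) (c : α) (hKc : (ped K τ).step c ≤ K)
    {C : T4PrintedShapeBanking.Consts} {Rt : ℕ → ℕ} (hE₂ : 0 ≤ C.E₂) (hE₃ : 0 ≤ C.E₃) {φ : ℝ} (hφ0 : 0 < φ)
    (hφ : ∀ m, m ≤ K → φ ≤ T4PrintedShapeBanking.floorK C K Rt m) (hc : ConsistentTLE Prod.fst C K Rt ((ped K τ).genT c))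
    {st m : ℕ} (hst : 1 ≤ st) (hm : ∀ u : ℕ, u + st ≤ K → levelOf (s K) K u + m ≤ levelOf (s K) K (u + st))
    (hsmall : (((2 * cth 32 1 st + 1) ^ d : ℕ) : ℝ) * (5 : ℝ) ^ d * ((max 1 (2 * 32 + 2) : ℕ) : ℝ) ≤ (L : ℝ) ^ m / 2)
    {θ : ℝ} (hθ0 : 0 ≤ θ) (hθ1 : θ < 1) (hθs : 1 / 2 ≤ θ ^ st) :
    ((koccOf ped liveC (cellOfR n L s ped cellP) (physV n L hn hL M hM s ped cellP) jstar T K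
        (kslot (keyOf ped (cellOfR n L s ped cellP) (physV n L hn hL M hM s ped cellP) K τ c))).card : ℝ) ≤
      (A d (M K) (tcap d ((ped K τ).sortR.gen c).root.fat) : ℝ) *
        (Real.exp ((2 +
              ((2 * (((2 * cth 32 1 st + 1) ^ d : ℕ) : ℝ) * ((((2 * 32 + 1) ^ d : ℕ) : ℝ) * (4 * 2 ^ d)) +
                    4 * ((((2 * cth 32 1 st + 1) ^ d : ℕ) : ℝ) * (5 : ℝ) ^ d)) / (1 - θ) +
                2 * (2 * ((((2 * cth 32 1 st + 1) ^ d : ℕ) : ℝ) * (5 : ℝ) ^ d))) +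
              (2 * ((0 + 2 * Real.log (2 * d + 1)) + (2 * (d : ℝ) + 2 * Real.log (2 * d + 1)) *
                    (((max 1 (2 * 32 + 2) : ℕ) : ℝ) * (2 * ((((2 * cth 32 1 st + 1) ^ d : ℕ) : ℝ) * (5 : ℝ) ^ d)))) +
                (2 * (d : ℝ) + 2 * Real.log (2 * d + 1)) * 1 *
                  (((max 1 (2 * 32 + 2) : ℕ) : ℝ) *
                      ((2 * (((2 * cth 32 1 st + 1) ^ d : ℕ) : ℝ) * ((((2 * 32 + 1) ^ d : ℕ) : ℝ) * (4 * 2 ^ d)) +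
                          4 * ((((2 * cth 32 1 st + 1) ^ d : ℕ) : ℝ) * (5 : ℝ) ^ d)) / (1 - θ)) +
                    4 * 2 ^ d)) +
              10) * bsum (fun b => ((b.fat : ℕ) : ℝ) + 1) ((ped K τ).gen c) +
            8 / φ * totalCostT Prod.fst C K Rt ((ped K τ).genT c)) *
          (((L : ℝ) ^ d) * Real.exp 4) ^ partnerAges PEv.step ((ped K τ).gen c)) :=
  -- the counting devices: depth, junk datum, tie-break order
  card_koccOf_le_real hn hL3 M hM s ped cellP liveC jstar T R (K := K) (fun _ => ⟨0, side_pos hn hL K⟩, Template.zero (hM K))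
    (Fintype.equivFin (Addr ((baddr ((ped K τ).sortR.gen c)).sup List.length) → TCell d (n * L ^ K) × Template d (M K)))
    hL (Fintype.equivFin _).injective hs hdrop hH hS hreal hinBox hstep hMf hdis hτ c
    (fun _ ha => Finset.le_sup (f := List.length) ha)
    fun z => card_S_sortR_le_exp_pow (ped K τ) _ (hH τ hτ) (hS τ hτ) hF hE₂ hE₃ hφ0 hφ c hc hKc
      (le_trans (by norm_num) hL3) hn (levelFn_levelOf (fun t _ => hs t) (hdrop K)) hst hm hsmall hθ0 hθ1 hθs z

end CountReal

end

end Summit.QuantumFields.BalabanUV.T4Continuum.HistoryJoinsPlacedMult
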